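import Summits.Ventures.HodgeRepro.Night3WeilModelCensus
import Summits.Ventures.HodgeRepro.Night3CensusS4Rows

/-!
# «S4 on the sealed census representatives ⟹ S4» in every Weil model, for the eleven sealed rows

Blind re-derivation cell `pub-hodge-repro`, seat `night-3` (gen 3).  Imports night-3's `Night3WeilModelCensus`
(`WeilModel.alg_of_reps`, generic) and `Night3CensusS4Rows` (the eleven sealed instances of the predicate form and
`alg_of_sexticFace`).  Namespace `HodgeRepro.Night3`.

In a Weil model `X` over the multisets of CM types of a sealed Galois CM type `(Elt Γ, conj Γ)`, read `Alg M` as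
«`W_F(B_M)` is algebraic» = `X.W M ≤ X.Alg M`.  Lemma P is supplied by `X.alg_add` / `X.alg_cancel`; the remaining
hypotheses are `hpair` (Lefschetz (1,1) on the conjugate pairs), `htwist` (Galois twists preserve algebraicity:
`B_{M·g} = B_M` with `F` acting through `g`) and `hreps` — S4 on the corner products of the row's sealed representatives
(1 / 3, 4, 4, 6, 5, 3 / 20, 22, 26, 20 of them).  Conclusion: `W_F(B_M)` is algebraic for every zero-sum `M` — S4 for
every corner product of that Galois CM field, with the open input counted exactly as the sealed census counts it;
`WeilModel.alg_of_sexticFace` spells out degree 6 (ONE face).  Nothing here closes S4; no sealed file is touched; no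
Tier-2 item depends on this file.
-/

set_option autoImplicit false

namespace HodgeRepro.Night3

open Summit.Ventures.HodgeRepro.FaceCensus
open HodgeRepro.EngineBridge
open HodgeRepro.Night3.GSet
open HodgeRepro.Night3.Census
open scoped Pointwise

universe u

variable {K L : Type*} [Field K] [Field L] [Algebra K L] {ι : Type*}

/-- **Row `Sextic.Cyclic`** (degree 6, cyclic; 1 representative) in a Weil model: S4 on the sealed representatives' corner products ⟹ S4 for every
corner product. -/
theorem WeilModel.alg_of_reps_sexticCyclic [Infinite K] [Fintype ι]
    (X : WeilModel.{u} K L ι (Multiset (Finset (Elt Sextic.Cyclic.Γ))))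
    (hpair : ∀ Φ, IsCMType (Elt.conj Sextic.Cyclic.Γ) Φ →
      X.W {Φ, Elt.conj Sextic.Cyclic.Γ • Φ} ≤ X.Alg {Φ, Elt.conj Sextic.Cyclic.Γ • Φ})
    (htwist : ∀ M g, X.W M ≤ X.Alg M → X.W (twistMul M g) ≤ X.Alg (twistMul M g))
    (hreps : ∀ r ∈ Sextic.Cyclic.reps, X.W (cornersMul Sextic.Cyclic.Γ r) ≤ X.Alg (cornersMul Sextic.Cyclic.Γ r))
    (M : Multiset (Finset (Elt Sextic.Cyclic.Γ))) (hM : IsZeroSumG (Elt.conj Sextic.Cyclic.Γ) M) : X.W M ≤ X.Alg M :=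
  WeilModel.alg_of_reps Sextic.Cyclic.Γ Sextic.Cyclic.reps coversFaces_sexticCyclic X hpair htwist hreps M hM

/-- **Row `Octic.Cyclic`** (degree 8, cyclic; 3) in a Weil model: S4 on the sealed representatives' corner products ⟹ S4 for every
corner product. -/
theorem WeilModel.alg_of_reps_octicCyclic [Infinite K] [Fintype ι]
    (X : WeilModel.{u} K L ι (Multiset (Finset (Elt Octic.Cyclic.Γ))))
    (hpair : ∀ Φ, IsCMType (Elt.conj Octic.Cyclic.Γ) Φ →
      X.W {Φ, Elt.conj Octic.Cyclic.Γ • Φ} ≤ X.Alg {Φ, Elt.conj Octic.Cyclic.Γ • Φ})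
    (htwist : ∀ M g, X.W M ≤ X.Alg M → X.W (twistMul M g) ≤ X.Alg (twistMul M g))
    (hreps : ∀ r ∈ Octic.Cyclic.reps, X.W (cornersMul Octic.Cyclic.Γ r) ≤ X.Alg (cornersMul Octic.Cyclic.Γ r))
    (M : Multiset (Finset (Elt Octic.Cyclic.Γ))) (hM : IsZeroSumG (Elt.conj Octic.Cyclic.Γ) M) : X.W M ≤ X.Alg M :=
  WeilModel.alg_of_reps Octic.Cyclic.Γ Octic.Cyclic.reps coversFaces_octicCyclic X hpair htwist hreps M hM

/-- **Row `Octic.C4C2Square`** (degree 8, `ℤ/4 × ℤ/2`, `c` a square; 4) in a Weil model: S4 on the sealed representatives' corner products ⟹ S4 for every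
corner product. -/
theorem WeilModel.alg_of_reps_octicC4C2Square [Infinite K] [Fintype ι]
    (X : WeilModel.{u} K L ι (Multiset (Finset (Elt Octic.C4C2Square.Γ))))
    (hpair : ∀ Φ, IsCMType (Elt.conj Octic.C4C2Square.Γ) Φ →
      X.W {Φ, Elt.conj Octic.C4C2Square.Γ • Φ} ≤ X.Alg {Φ, Elt.conj Octic.C4C2Square.Γ • Φ})
    (htwist : ∀ M g, X.W M ≤ X.Alg M → X.W (twistMul M g) ≤ X.Alg (twistMul M g))
    (hreps : ∀ r ∈ Octic.C4C2Square.reps, X.W (cornersMul Octic.C4C2Square.Γ r) ≤ X.Alg (cornersMul Octic.C4C2Square.Γ r))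
    (M : Multiset (Finset (Elt Octic.C4C2Square.Γ))) (hM : IsZeroSumG (Elt.conj Octic.C4C2Square.Γ) M) : X.W M ≤ X.Alg M :=
  WeilModel.alg_of_reps Octic.C4C2Square.Γ Octic.C4C2Square.reps coversFaces_octicC4C2Square X hpair htwist hreps M hM

/-- **Row `Octic.C4C2Nonsquare`** (degree 8, `ℤ/4 × ℤ/2`, `c` a non-square; 4) in a Weil model: S4 on the sealed representatives' corner products ⟹ S4 for every
corner product. -/
theorem WeilModel.alg_of_reps_octicC4C2Nonsquare [Infinite K] [Fintype ι]
    (X : WeilModel.{u} K L ι (Multiset (Finset (Elt Octic.C4C2Nonsquare.Γ))))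
    (hpair : ∀ Φ, IsCMType (Elt.conj Octic.C4C2Nonsquare.Γ) Φ →
      X.W {Φ, Elt.conj Octic.C4C2Nonsquare.Γ • Φ} ≤ X.Alg {Φ, Elt.conj Octic.C4C2Nonsquare.Γ • Φ})
    (htwist : ∀ M g, X.W M ≤ X.Alg M → X.W (twistMul M g) ≤ X.Alg (twistMul M g))
    (hreps : ∀ r ∈ Octic.C4C2Nonsquare.reps, X.W (cornersMul Octic.C4C2Nonsquare.Γ r) ≤ X.Alg (cornersMul Octic.C4C2Nonsquare.Γ r))
    (M : Multiset (Finset (Elt Octic.C4C2Nonsquare.Γ))) (hM : IsZeroSumG (Elt.conj Octic.C4C2Nonsquare.Γ) M) : X.W M ≤ X.Alg M :=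
  WeilModel.alg_of_reps Octic.C4C2Nonsquare.Γ Octic.C4C2Nonsquare.reps coversFaces_octicC4C2Nonsquare X hpair htwist hreps M hM

/-- **Row `Octic.Triquadratic`** (degree 8, triquadratic; 6) in a Weil model: S4 on the sealed representatives' corner products ⟹ S4 for every
corner product. -/
theorem WeilModel.alg_of_reps_octicTriquadratic [Infinite K] [Fintype ι]
    (X : WeilModel.{u} K L ι (Multiset (Finset (Elt Octic.Triquadratic.Γ))))
    (hpair : ∀ Φ, IsCMType (Elt.conj Octic.Triquadratic.Γ) Φ →
      X.W {Φ, Elt.conj Octic.Triquadratic.Γ • Φ} ≤ X.Alg {Φ, Elt.conj Octic.Triquadratic.Γ • Φ})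
    (htwist : ∀ M g, X.W M ≤ X.Alg M → X.W (twistMul M g) ≤ X.Alg (twistMul M g))
    (hreps : ∀ r ∈ Octic.Triquadratic.reps, X.W (cornersMul Octic.Triquadratic.Γ r) ≤ X.Alg (cornersMul Octic.Triquadratic.Γ r))
    (M : Multiset (Finset (Elt Octic.Triquadratic.Γ))) (hM : IsZeroSumG (Elt.conj Octic.Triquadratic.Γ) M) : X.W M ≤ X.Alg M :=
  WeilModel.alg_of_reps Octic.Triquadratic.Γ Octic.Triquadratic.reps coversFaces_octicTriquadratic X hpair htwist hreps M hM

/-- **Row `Octic.Dihedral`** (degree 8, dihedral; 5) in a Weil model: S4 on the sealed representatives' corner products ⟹ S4 for every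
corner product. -/
theorem WeilModel.alg_of_reps_octicDihedral [Infinite K] [Fintype ι]
    (X : WeilModel.{u} K L ι (Multiset (Finset (Elt Octic.Dihedral.Γ))))
    (hpair : ∀ Φ, IsCMType (Elt.conj Octic.Dihedral.Γ) Φ →
      X.W {Φ, Elt.conj Octic.Dihedral.Γ • Φ} ≤ X.Alg {Φ, Elt.conj Octic.Dihedral.Γ • Φ})
    (htwist : ∀ M g, X.W M ≤ X.Alg M → X.W (twistMul M g) ≤ X.Alg (twistMul M g))
    (hreps : ∀ r ∈ Octic.Dihedral.reps, X.W (cornersMul Octic.Dihedral.Γ r) ≤ X.Alg (cornersMul Octic.Dihedral.Γ r))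
    (M : Multiset (Finset (Elt Octic.Dihedral.Γ))) (hM : IsZeroSumG (Elt.conj Octic.Dihedral.Γ) M) : X.W M ≤ X.Alg M :=
  WeilModel.alg_of_reps Octic.Dihedral.Γ Octic.Dihedral.reps coversFaces_octicDihedral X hpair htwist hreps M hM

/-- **Row `Octic.Quaternion`** (degree 8, quaternion; 3) in a Weil model: S4 on the sealed representatives' corner products ⟹ S4 for every
corner product. -/
theorem WeilModel.alg_of_reps_octicQuaternion [Infinite K] [Fintype ι]
    (X : WeilModel.{u} K L ι (Multiset (Finset (Elt Octic.Quaternion.Γ))))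
    (hpair : ∀ Φ, IsCMType (Elt.conj Octic.Quaternion.Γ) Φ →
      X.W {Φ, Elt.conj Octic.Quaternion.Γ • Φ} ≤ X.Alg {Φ, Elt.conj Octic.Quaternion.Γ • Φ})
    (htwist : ∀ M g, X.W M ≤ X.Alg M → X.W (twistMul M g) ≤ X.Alg (twistMul M g))
    (hreps : ∀ r ∈ Octic.Quaternion.reps, X.W (cornersMul Octic.Quaternion.Γ r) ≤ X.Alg (cornersMul Octic.Quaternion.Γ r))
    (M : Multiset (Finset (Elt Octic.Quaternion.Γ))) (hM : IsZeroSumG (Elt.conj Octic.Quaternion.Γ) M) : X.W M ≤ X.Alg M :=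
  WeilModel.alg_of_reps Octic.Quaternion.Γ Octic.Quaternion.reps coversFaces_octicQuaternion X hpair htwist hreps M hM

/-- **Row `Duodecic.Cyclic`** (degree 12, cyclic; 20) in a Weil model: S4 on the sealed representatives' corner products ⟹ S4 for every
corner product. -/
theorem WeilModel.alg_of_reps_duodecicCyclic [Infinite K] [Fintype ι]
    (X : WeilModel.{u} K L ι (Multiset (Finset (Elt Duodecic.Cyclic.Γ))))
    (hpair : ∀ Φ, IsCMType (Elt.conj Duodecic.Cyclic.Γ) Φ →
      X.W {Φ, Elt.conj Duodecic.Cyclic.Γ • Φ} ≤ X.Alg {Φ, Elt.conj Duodecic.Cyclic.Γ • Φ})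
    (htwist : ∀ M g, X.W M ≤ X.Alg M → X.W (twistMul M g) ≤ X.Alg (twistMul M g))
    (hreps : ∀ r ∈ Duodecic.Cyclic.reps, X.W (cornersMul Duodecic.Cyclic.Γ r) ≤ X.Alg (cornersMul Duodecic.Cyclic.Γ r))
    (M : Multiset (Finset (Elt Duodecic.Cyclic.Γ))) (hM : IsZeroSumG (Elt.conj Duodecic.Cyclic.Γ) M) : X.W M ≤ X.Alg M :=
  WeilModel.alg_of_reps Duodecic.Cyclic.Γ Duodecic.Cyclic.reps coversFaces_duodecicCyclic X hpair htwist hreps M hM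

/-- **Row `Duodecic.C6C2`** (degree 12, `ℤ/6 × ℤ/2`; 22) in a Weil model: S4 on the sealed representatives' corner products ⟹ S4 for every
corner product. -/
theorem WeilModel.alg_of_reps_duodecicC6C2 [Infinite K] [Fintype ι]
    (X : WeilModel.{u} K L ι (Multiset (Finset (Elt Duodecic.C6C2.Γ))))
    (hpair : ∀ Φ, IsCMType (Elt.conj Duodecic.C6C2.Γ) Φ →
      X.W {Φ, Elt.conj Duodecic.C6C2.Γ • Φ} ≤ X.Alg {Φ, Elt.conj Duodecic.C6C2.Γ • Φ})
    (htwist : ∀ M g, X.W M ≤ X.Alg M → X.W (twistMul M g) ≤ X.Alg (twistMul M g))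
    (hreps : ∀ r ∈ Duodecic.C6C2.reps, X.W (cornersMul Duodecic.C6C2.Γ r) ≤ X.Alg (cornersMul Duodecic.C6C2.Γ r))
    (M : Multiset (Finset (Elt Duodecic.C6C2.Γ))) (hM : IsZeroSumG (Elt.conj Duodecic.C6C2.Γ) M) : X.W M ≤ X.Alg M :=
  WeilModel.alg_of_reps Duodecic.C6C2.Γ Duodecic.C6C2.reps coversFaces_duodecicC6C2 X hpair htwist hreps M hM

/-- **Row `Duodecic.Dihedral`** (degree 12, dihedral; 26) in a Weil model: S4 on the sealed representatives' corner products ⟹ S4 for every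
corner product. -/
theorem WeilModel.alg_of_reps_duodecicDihedral [Infinite K] [Fintype ι]
    (X : WeilModel.{u} K L ι (Multiset (Finset (Elt Duodecic.Dihedral.Γ))))
    (hpair : ∀ Φ, IsCMType (Elt.conj Duodecic.Dihedral.Γ) Φ →
      X.W {Φ, Elt.conj Duodecic.Dihedral.Γ • Φ} ≤ X.Alg {Φ, Elt.conj Duodecic.Dihedral.Γ • Φ})
    (htwist : ∀ M g, X.W M ≤ X.Alg M → X.W (twistMul M g) ≤ X.Alg (twistMul M g))
    (hreps : ∀ r ∈ Duodecic.Dihedral.reps, X.W (cornersMul Duodecic.Dihedral.Γ r) ≤ X.Alg (cornersMul Duodecic.Dihedral.Γ r))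
    (M : Multiset (Finset (Elt Duodecic.Dihedral.Γ))) (hM : IsZeroSumG (Elt.conj Duodecic.Dihedral.Γ) M) : X.W M ≤ X.Alg M :=
  WeilModel.alg_of_reps Duodecic.Dihedral.Γ Duodecic.Dihedral.reps coversFaces_duodecicDihedral X hpair htwist hreps M hM

/-- **Row `Duodecic.Dicyclic`** (degree 12, dicyclic; 20) in a Weil model: S4 on the sealed representatives' corner products ⟹ S4 for every
corner product. -/
theorem WeilModel.alg_of_reps_duodecicDicyclic [Infinite K] [Fintype ι]
    (X : WeilModel.{u} K L ι (Multiset (Finset (Elt Duodecic.Dicyclic.Γ))))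
    (hpair : ∀ Φ, IsCMType (Elt.conj Duodecic.Dicyclic.Γ) Φ →
      X.W {Φ, Elt.conj Duodecic.Dicyclic.Γ • Φ} ≤ X.Alg {Φ, Elt.conj Duodecic.Dicyclic.Γ • Φ})
    (htwist : ∀ M g, X.W M ≤ X.Alg M → X.W (twistMul M g) ≤ X.Alg (twistMul M g))
    (hreps : ∀ r ∈ Duodecic.Dicyclic.reps, X.W (cornersMul Duodecic.Dicyclic.Γ r) ≤ X.Alg (cornersMul Duodecic.Dicyclic.Γ r))
    (M : Multiset (Finset (Elt Duodecic.Dicyclic.Γ))) (hM : IsZeroSumG (Elt.conj Duodecic.Dicyclic.Γ) M) : X.W M ≤ X.Alg M :=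
  WeilModel.alg_of_reps Duodecic.Dicyclic.Γ Duodecic.Dicyclic.reps coversFaces_duodecicDicyclic X hpair htwist hreps M hM

/-- **Degree 6 in a Weil model, explicitly**: if the Weil space of the corner product of the ONE sealed sextic face
`(7; 9, 18)` is algebraic (+ hpair / htwist), then the Weil space of every zero-sum corner product of the cyclic sextic
CM type is algebraic. -/
theorem WeilModel.alg_of_sexticFace [Infinite K] [Fintype ι]
    (X : WeilModel.{u} K L ι (Multiset (Finset (Elt Sextic.Cyclic.Γ))))
    (hpair : ∀ Φ, IsCMType (Elt.conj Sextic.Cyclic.Γ) Φ →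
      X.W {Φ, Elt.conj Sextic.Cyclic.Γ • Φ} ≤ X.Alg {Φ, Elt.conj Sextic.Cyclic.Γ • Φ})
    (htwist : ∀ M g, X.W M ≤ X.Alg M → X.W (twistMul M g) ≤ X.Alg (twistMul M g))
    (hface : X.W (cornersMul Sextic.Cyclic.Γ (7, 9, 18)) ≤ X.Alg (cornersMul Sextic.Cyclic.Γ (7, 9, 18)))
    (M : Multiset (Finset (Elt Sextic.Cyclic.Γ))) (hM : IsZeroSumG (Elt.conj Sextic.Cyclic.Γ) M) :
    X.W M ≤ X.Alg M :=
  Census.alg_of_sexticFace (fun N => X.W N ≤ X.Alg N)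
    (fun M N _ _ => X.alg_add M N) (fun M N _ _ => X.alg_cancel M N) hpair htwist hface M hM

end HodgeRepro.Night3
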